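import Summits.CriticalPhenomena.SAWScalingLimit.Theorems.CriticalBubbleBound.Negative.CriticalBubbleBoundWordReflection

/-!
# Negative-side results for the crux `SAWTotalPositivity.CriticalBubbleBound` (stmt-CriticalPhenomena-7117):
BOUNDARY ≠ BULK IN THE MEMORYLESS MODEL — the planner's foreseen glue
`HalfPlaneBubble → BulkFromBoundary → CriticalBubbleBound` has NO kernel-level reason.

At the memoryless critical fugacity `1/4` (all nearest-neighbour words of `ℤ²`, work-file §14) the
ARCH kernel `H_{1/4}(e₀) = Σ_n h_n(e₀) 4^{-n}` between the two adjacent boundary sites `0, e₀` of the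
closed upper half-plane is FINITE (`hpKernel_quarter_e₀_ne_top`: `h_{2m+1}(e₀) 4^{-(2m+1)} ≤ 2/(m+2)²`,
reflection principle at level `-1` + the exact diagonal-coordinates count
`w_{2m+1}(e₀) = C(2m+1,m+1)²` + `C(2n,n)²(n+1) ≤ 16ⁿ`), while the BULK kernel between the same two
sites is INFINITE (`rwKernel_quarter_e₀_eq_top`, Pólya, landed in `CriticalBubbleBoundRandomWalkFalse`).
Hence `not_bulkFromBoundaryMemoryless`: "arch kernel finite ⇒ bulk kernel finite" fails in the one
exactly solvable comparison model by a full power of `n` (`n^{-2}` against `n^{-1}` terms); for the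
SAW the boundary-to-bulk passage must come from the polygon structure (re-rooting the loop
`γ ∪ {e₀, 0}`, multiplicity = position of the root edge), i.e. from self-avoidance itself
(work-file §9a, §17).

Refuter `cdisprove` (standing adversary, gen 4); the full indexed work file is
`Summits/CriticalPhenomena/SAWScalingLimit/Cruxes/CriticalBubbleBound/Disproof.lean` (§17).
-/

noncomputable section

open MeasureTheory Filter Topology Set Function
open Literature.Probability.LatticeModels
open Literature.Probability.RandomPlanarGeometry Literature.Probability.RandomPlanarGeometry.SAW
open scoped ENNReal NNReal BigOperators

namespace Summit.CriticalPhenomena.SAWScalingLimit.Theorems.CriticalBubbleBound.Negative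

/-! ## §17 Boundary versus bulk in the memoryless model (part 2 of 2)

### Arches: words in the closed upper half-plane -/

/-- The word stays in the closed upper half-plane `{y ≥ 0}`. [folklore] -/
def StaysUp (w : List Step) : Prop := ∀ i, i ≤ w.length → 0 ≤ traj w i 1

open Classical in
/-- `h_n(v)`: the number of `n`-step words from `0` to `v` staying in `{y ≥ 0}` — memoryless
ARCHES between boundary points of the half-plane when `v = e₀`. [folklore] -/
def hpCountAt (n : ℕ) (v : Site 2) : ℕ :=
  (((words n).filter fun w => wEnd w = v).filter StaysUp).card

/-- Arches are words: `h_n(v) ≤ w_n(v)`. [folklore] -/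
theorem hpCountAt_le_rwCountAt (n : ℕ) (v : Site 2) : hpCountAt n v ≤ rwCountAt n v := by
  classical
  rw [hpCountAt, rwCountAt]
  convert Finset.card_filter_le _ _

/-- A word ending at ordinate `-2` dips. [folklore] -/
theorem dips_of_wEnd_eq_v₂ {w : List Step} (hv : wEnd w = v₂) : Dips w :=
  ⟨w.length, le_rfl, by rw [traj_length, hv]; simp [v₂]⟩

/-- **REFLECTION COUNT**: `h_n(e₀) + w_n((1,-2)) ≤ w_n(e₀)` — the tail reflection injects the
words ending at `(1,-2)` into the words ending at `e₀` that dip below the axis. [folklore] -/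
theorem hpCountAt_add_rwCountAt_v₂_le (n : ℕ) :
    hpCountAt n e₀ + rwCountAt n v₂ ≤ rwCountAt n e₀ := by
  classical
  set All := (words n).filter fun w => wEnd w = e₀ with hAll
  have hsplit : (All.filter StaysUp).card + (All.filter fun w => ¬ StaysUp w).card = All.card :=
    Finset.card_filter_add_card_filter_not _
  have hgood : hpCountAt n e₀ = (All.filter StaysUp).card := by
    rw [hpCountAt]
  have hall : rwCountAt n e₀ = All.card := by rw [rwCountAt]
  have hS : rwCountAt n v₂ ≤ (All.filter fun w => ¬ StaysUp w).card := by
    rw [rwCountAt]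
    refine Finset.card_le_card_of_injOn reflectTail (fun w hw => ?_) ?_
    · rw [Finset.mem_coe, Finset.mem_filter, mem_words] at hw
      have hD := dips_of_wEnd_eq_v₂ hw.2
      have hE := wEnd_reflectTail hD
      rw [hw.2] at hE
      simp only [v₂, Matrix.cons_val_zero, Matrix.cons_val_one, Matrix.cons_val_fin_one] at hE
      rw [Finset.mem_coe, Finset.mem_filter, hAll, Finset.mem_filter, mem_words, length_reflectTail]
      refine ⟨⟨hw.1, ?_⟩, ?_⟩
      · funext j
        fin_cases j
        · simp only [e₀, Fin.zero_eta, Fin.isValue, Matrix.cons_val_zero]; exact hE.1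
        · simp only [e₀, Fin.mk_one, Fin.isValue, Matrix.cons_val_one, Matrix.cons_val_fin_one]
          rw [hE.2]; ring
      · intro hup
        have h1 := hup (dipTime w) (by rw [length_reflectTail]; exact dipTime_le_length w)
        rw [traj_reflectTail_of_le w le_rfl, traj_dipTime_eq hD] at h1
        norm_num at h1
    · intro w₁ hw₁ w₂ hw₂ heq
      rw [Finset.mem_coe, Finset.mem_filter] at hw₁ hw₂
      have h1 := reflectTail_reflectTail (dips_of_wEnd_eq_v₂ hw₁.2)
      have h2 := reflectTail_reflectTail (dips_of_wEnd_eq_v₂ hw₂.2)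
      rw [← h1, ← h2, heq]
  omega


/-! ### Binomial algebra: `2 (m+2)² · h_{2m+1}(e₀) ≤ 16^{m+1}` -/

/-- `C(2n,n)² (n+1) ≤ 16ⁿ` (the squared form of `C(2n,n) ≤ 4ⁿ/√(n+1)`), by induction from
`(n+1) C(2n+2,n+1) = 2(2n+1) C(2n,n)` and `(2n+1)²(n+2) ≤ 4(n+1)³`. [folklore] -/
theorem centralBinom_sq_mul_succ_le (n : ℕ) : n.centralBinom ^ 2 * (n + 1) ≤ 16 ^ n := by
  induction n with
  | zero => simp [Nat.centralBinom]
  | succ n ih =>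
    have key : (n + 1) * (n + 1).centralBinom = 2 * (2 * n + 1) * n.centralBinom :=
      Nat.succ_mul_centralBinom_succ n
    have h2 : (n + 1) ^ 2 * ((n + 1).centralBinom ^ 2 * (n + 1 + 1)) ≤ (n + 1) ^ 2 * 16 ^ (n + 1) :=
      calc (n + 1) ^ 2 * ((n + 1).centralBinom ^ 2 * (n + 1 + 1))
          = ((n + 1) * (n + 1).centralBinom) ^ 2 * (n + 2) := by ring
        _ = (2 * (2 * n + 1) * n.centralBinom) ^ 2 * (n + 2) := by rw [key]
        _ = 4 * n.centralBinom ^ 2 * ((2 * n + 1) ^ 2 * (n + 2)) := by ring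
        _ ≤ 4 * n.centralBinom ^ 2 * (4 * (n + 1) ^ 3) := by
            apply Nat.mul_le_mul_left
            nlinarith
        _ = 16 * (n + 1) ^ 2 * (n.centralBinom ^ 2 * (n + 1)) := by ring
        _ ≤ 16 * (n + 1) ^ 2 * 16 ^ n := Nat.mul_le_mul_left _ ih
        _ = (n + 1) ^ 2 * 16 ^ (n + 1) := by ring
    exact Nat.le_of_mul_le_mul_left h2 (by positivity)

/-- **ARCH COUNT**: `2 (m+2)² · h_{2m+1}(e₀) ≤ 16^{m+1}` (in fact `h_{2m+1}(e₀) =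
2 C(2m+1,m+1)²/(m+2) ∼ (8/π) 16^m m^{-2}`: the half-plane local exponent is `2`, not `1`). [folklore] -/
theorem hpCountAt_bound (m : ℕ) :
    2 * (m + 2) ^ 2 * hpCountAt (2 * m + 1) e₀ ≤ 16 ^ (m + 1) := by
  set c := (2 * m + 1).choose (m + 1) with hc
  have h1 := hpCountAt_add_rwCountAt_v₂_le (2 * m + 1)
  have h2 := rwCountAt_e₀_le_choose_sq m
  have h3 := choose_mul_choose_le_rwCountAt_v₂ m
  have hsymm : (2 * m + 1).choose m = c := (Nat.choose_symm_half m).symm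
  have hsucc : (2 * m + 1).choose (m + 2) * (m + 2) = c * m := by
    have := Nat.choose_succ_right_eq (2 * m + 1) (m + 1)
    rw [this, show 2 * m + 1 - (m + 1) = m by omega]
  have hcb : (m + 1).centralBinom = 2 * c := by
    rw [Nat.centralBinom_eq_two_mul_choose, show 2 * (m + 1) = (2 * m + 1) + 1 by ring,
      Nat.choose_succ_succ', hsymm]
    ring
  have h4 := centralBinom_sq_mul_succ_le (m + 1)
  rw [hcb] at h4
  have h5 : hpCountAt (2 * m + 1) e₀ + c * (2 * m + 1).choose (m + 2) ≤ c ^ 2 := by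
    rw [hsymm] at h3
    exact (Nat.add_le_add_left h3 _).trans (h1.trans h2)
  have h6 : (m + 2) * hpCountAt (2 * m + 1) e₀ + c * (c * m) ≤ (m + 2) * c ^ 2 := by
    have := Nat.mul_le_mul_left (m + 2) h5
    calc (m + 2) * hpCountAt (2 * m + 1) e₀ + c * (c * m)
        = (m + 2) * (hpCountAt (2 * m + 1) e₀ + c * (2 * m + 1).choose (m + 2)) := by
          rw [← hsucc]; ring
      _ ≤ (m + 2) * c ^ 2 := this
  have h7 : (m + 2) * hpCountAt (2 * m + 1) e₀ ≤ 2 * c ^ 2 := by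
    have : (m + 2) * c ^ 2 = c * (c * m) + 2 * c ^ 2 := by ring
    rw [this] at h6
    omega
  calc 2 * (m + 2) ^ 2 * hpCountAt (2 * m + 1) e₀
      = (m + 2) * (2 * ((m + 2) * hpCountAt (2 * m + 1) e₀)) := by ring
    _ ≤ (m + 2) * (2 * (2 * c ^ 2)) := by gcongr
    _ = (2 * c) ^ 2 * (m + 1 + 1) := by ring
    _ ≤ 16 ^ (m + 1) := h4

/-! ### The memoryless half-plane kernel is FINITE at the critical fugacity `1/4` -/

/-- The memoryless HALF-PLANE kernel `H_x(v) := Σ_n h_n(v) xⁿ ∈ [0,∞]` (arches). [folklore] -/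
def hpKernel (x : ℝ) (v : Site 2) : ℝ≥0∞ :=
  ∑' n : ℕ, (hpCountAt n v : ℝ≥0∞) * ENNReal.ofReal (x ^ n)

/-- `H_x(v) ≤ R_x(v)`. [folklore] -/
theorem hpKernel_le_rwKernel (x : ℝ) (v : Site 2) : hpKernel x v ≤ rwKernel x v :=
  ENNReal.tsum_le_tsum fun n => by
    gcongr
    exact_mod_cast hpCountAt_le_rwCountAt n v

/-- Termwise: `h_{2m+1}(e₀) 4^{-(2m+1)} ≤ 2/(m+2)²`. [folklore] -/
theorem hp_term_bound (m : ℕ) :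
    (hpCountAt (2 * m + 1) e₀ : ℝ≥0∞) * ENNReal.ofReal ((1 / 4 : ℝ) ^ (2 * m + 1)) ≤
      ENNReal.ofReal (2 / ((m : ℝ) + 2) ^ 2) := by
  have h : (2 : ℝ) * ((m : ℝ) + 2) ^ 2 * hpCountAt (2 * m + 1) e₀ ≤ 16 ^ (m + 1) := by
    exact_mod_cast hpCountAt_bound m
  rw [← ENNReal.ofReal_natCast, ← ENNReal.ofReal_mul (by positivity)]
  apply ENNReal.ofReal_le_ofReal
  have h4 : (1 / 4 : ℝ) ^ (2 * m + 1) = 1 / (4 * 16 ^ m) := by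
    rw [one_div_pow, pow_succ, pow_mul]
    ring
  rw [h4, mul_one_div, div_le_div_iff₀ (by positivity) (by positivity)]
  have h16 : (16 : ℝ) ^ (m + 1) = 16 * 16 ^ m := by ring
  rw [h16] at h
  nlinarith [h, pow_pos (show (0:ℝ) < 16 by norm_num) m]

/-- `Σ_m 2/(m+2)² < ∞`. [folklore] -/
theorem summable_two_div_sq : Summable fun m : ℕ => 2 / ((m : ℝ) + 2) ^ 2 := by
  have h : Summable fun n : ℕ => 1 / (n : ℝ) ^ 2 := Real.summable_one_div_nat_pow.mpr one_lt_two
  have h2 := (summable_nat_add_iff 2).mpr h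
  refine (h2.mul_left 2).congr fun m => ?_
  push_cast
  ring

/-- **THE MEMORYLESS HALF-PLANE KERNEL IS FINITE AT CRITICALITY**:
`H_{1/4}(e₀) = Σ_n h_n(e₀) 4^{-n} ≤ Σ_m 2/(m+2)² < ∞` — the expected number of visits to the
boundary neighbour `e₀` of planar simple random walk killed on leaving the closed upper
half-plane is finite (half-plane local limit exponent `2`), although the walk is recurrent. [folklore] -/
theorem hpKernel_quarter_e₀_ne_top : hpKernel (1 / 4) e₀ ≠ ⊤ := by
  set f : ℕ → ℝ≥0∞ := fun n => (hpCountAt n e₀ : ℝ≥0∞) * ENNReal.ofReal ((1 / 4 : ℝ) ^ n) with hf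
  have heven : ∀ k, f (2 * k) = 0 := fun k => by
    have h0 : hpCountAt (2 * k) e₀ = 0 :=
      Nat.eq_zero_of_le_zero ((hpCountAt_le_rwCountAt _ _).trans
        (rwCountAt_e₀_eq_zero_of_even (even_two_mul k)).le)
    simp [hf, h0]
  have hsplit : hpKernel (1 / 4) e₀ = ∑' k, f (2 * k + 1) := by
    rw [hpKernel]
    change ∑' n, f n = _
    rw [← tsum_even_add_odd (f := f) ENNReal.summable ENNReal.summable]
    simp only [heven, tsum_zero, zero_add]
  have hle : ∑' k, f (2 * k + 1) ≤ ∑' k : ℕ, ENNReal.ofReal (2 / ((k : ℝ) + 2) ^ 2) :=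
    ENNReal.tsum_le_tsum fun k => hp_term_bound k
  have hfin : ∑' k : ℕ, ENNReal.ofReal (2 / ((k : ℝ) + 2) ^ 2) ≠ ⊤ := by
    rw [← ENNReal.ofReal_tsum_of_nonneg (fun k => by positivity) summable_two_div_sq]
    exact ENNReal.ofReal_ne_top
  rw [hsplit]
  exact ne_top_of_le_ne_top hfin hle

/-- **BOUNDARY ≠ BULK IN THE MEMORYLESS MODEL.** At the memoryless critical fugacity `1/4`
the ARCH kernel between the two adjacent boundary sites `0, e₀` of the half-plane is FINITE
while the BULK kernel between the same two sites is INFINITE (§14, Pólya). So the passage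
"half-plane bubble finite ⇒ bulk bubble finite" (the planner's foreseen glue `BulkFromBoundary`,
§9a) is NOT a property of nearest-neighbour kernels with symmetric steps: in the one exactly
solvable comparison model it fails by a full power of `n` (`n^{-2}` versus `n^{-1}` terms). For
the SAW the same passage must therefore come from the POLYGON structure (re-rooting the closed
loop `γ ∪ {e₀,0}` at its lowest edge, §9a: multiplicity `m` = position of the root edge), i.e.
from self-avoidance, never from a kernel inequality. [folklore] -/
theorem boundary_finite_bulk_infinite_memoryless :
    hpKernel (1 / 4) e₀ ≠ ⊤ ∧ rwKernel (1 / 4) e₀ = ⊤ :=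
  ⟨hpKernel_quarter_e₀_ne_top, rwKernel_quarter_e₀_eq_top⟩

/-- `BulkFromBoundary` for the memoryless kernels at their critical point: "arch kernel finite
⇒ bulk kernel finite". -/
def BulkFromBoundaryMemoryless : Prop := hpKernel (1 / 4) e₀ ≠ ⊤ → rwKernel (1 / 4) e₀ ≠ ⊤

/-- **The memoryless `BulkFromBoundary` is FALSE** (its hypothesis holds, its conclusion fails). [folklore] -/
theorem not_bulkFromBoundaryMemoryless : ¬ BulkFromBoundaryMemoryless :=
  fun h => h hpKernel_quarter_e₀_ne_top rwKernel_quarter_e₀_eq_top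

end Summit.CriticalPhenomena.SAWScalingLimit.Theorems.CriticalBubbleBound.Negative
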